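import Summits.Ventures.HodgeRepro2.T5SU11ReductionOfOrder

/-!
# The second solution at the origin: `v(t) → −∞` as `t → 0⁺`, and the uniqueness of the regular solution

Row 443 (`T5SU11ReductionOfOrder`) built, from a positive solution `φ` of the radial equation
`sinh 2t · u″ + 2 cosh 2t · u′ = μ sinh 2t · u` on `(0, ∞)`, the second solution `v = φ · I` with
`I(t) = ∫_1^t ds/(sinh 2s · φ(s)²)`, and showed that every solution is `a φ + b v`. This file looks at `t → 0⁺`:
the integrand has the singularity `1/(2s φ(0)²)` there, so `I` diverges LOGARITHMICALLY. Quantitatively, from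
`sinh x ≤ x cosh x` (`sinh_le_mul_cosh`: `cosh` is increasing on `[0, x]`) and bounds `0 < m ≤ φ ≤ M` on `(0, 1]`,

  `1/(2 cosh 2 · M² · s) ≤ g(s)` on `(0, 1]` (`inv_le_roIntegrand`),  hence
  **`I(t) ≤ log t / (2 cosh 2 · M²)`** and **`v(t) ≤ m · log t / (2 cosh 2 · M²)`** for `0 < t < 1`
  (`roIntegral_le_log`, `secondSolution_le_log`), so **`v(t) → −∞` as `t → 0⁺`**
  (`tendsto_secondSolution_nhdsGT_zero`).

Consequently **the regular solution is unique**: a solution `u` on `(0, ∞)` that stays BOUNDED as `t → 0⁺` — in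
particular one with a finite limit there — has no `v`-component and equals `(u(1)/φ(1)) · φ`
(`eq_const_mul_of_bounded`, `eq_const_mul_of_tendsto`, `exists_eq_const_mul_of_bounded`). Nothing is claimed
about (N).

Blind lane: Mathlib + the HodgeRepro2 prefix only; no sorry; axioms ⊆ {propext, Classical.choice,
Quot.sound}.
-/

namespace Summit.Ventures.HodgeRepro2.T5SU11ReductionOfOrderOrigin

open Filter Topology MeasureTheory intervalIntegral
open Set (Ioi Ioo Icc uIcc)
open T5SU11ReductionOfOrder

/-! ### `sinh x ≤ x cosh x` -/

/-- **`sinh x ≤ x cosh x` for `x ≥ 0`**: `sinh x = ∫_0^x cosh ≤ x cosh x` since `cosh` is increasing on `[0, x]`. -/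
theorem sinh_le_mul_cosh {x : ℝ} (hx : 0 ≤ x) : Real.sinh x ≤ x * Real.cosh x := by
  have h1 : ∫ y in (0 : ℝ)..x, Real.cosh y = Real.sinh x - Real.sinh 0 :=
    integral_eq_sub_of_hasDerivAt (fun y _ => Real.hasDerivAt_sinh y)
      (Real.continuous_cosh.intervalIntegrable _ _)
  have h2 : ∫ y in (0 : ℝ)..x, Real.cosh y ≤ ∫ _ in (0 : ℝ)..x, Real.cosh x := by
    refine integral_mono_on hx (Real.continuous_cosh.intervalIntegrable _ _) intervalIntegrable_const ?_
    intro y hy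
    exact Real.cosh_le_cosh.mpr (by rw [abs_of_nonneg hy.1, abs_of_nonneg hx]; exact hy.2)
  rw [intervalIntegral.integral_const, smul_eq_mul, sub_zero] at h2
  rw [Real.sinh_zero, sub_zero] at h1
  linarith

/-- `sinh 2s ≤ 2 s cosh 2` for `0 ≤ s ≤ 1`. -/
theorem sinh_two_mul_le_of_le_one {s : ℝ} (hs0 : 0 ≤ s) (hs1 : s ≤ 1) :
    Real.sinh (2 * s) ≤ 2 * s * Real.cosh 2 := by
  have h1 := sinh_le_mul_cosh (by linarith : 0 ≤ 2 * s)
  have h2 : Real.cosh (2 * s) ≤ Real.cosh 2 := by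
    rw [Real.cosh_le_cosh, abs_of_nonneg (by linarith : (0 : ℝ) ≤ 2 * s), abs_of_nonneg (by norm_num : (0 : ℝ) ≤ 2)]
    linarith
  calc Real.sinh (2 * s) ≤ 2 * s * Real.cosh (2 * s) := h1
    _ ≤ 2 * s * Real.cosh 2 := mul_le_mul_of_nonneg_left h2 (by linarith)

section

variable {μ m M : ℝ} {φ φ' φ'' : ℝ → ℝ}
  (hφ : ∀ t, 0 < t → HasDerivAt φ (φ' t) t) (hφ' : ∀ t, 0 < t → HasDerivAt φ' (φ'' t) t)
  (hpos : ∀ t, 0 < t → 0 < φ t)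
  (hm : ∀ s, 0 < s → s ≤ 1 → m ≤ φ s) (hM : ∀ s, 0 < s → s ≤ 1 → φ s ≤ M)

/-! ### The logarithmic lower bound of the integral near `0` -/

include hpos hM in
/-- The upper bound `M` of `φ` on `(0, 1]` is positive. -/
theorem M_pos : 0 < M := lt_of_lt_of_le (hpos 1 one_pos) (hM 1 one_pos le_rfl)

include hpos hM in
/-- **`1/(2 cosh 2 · M² · s) ≤ g(s)`** on `(0, 1]`. -/
theorem inv_le_roIntegrand {s : ℝ} (hs0 : 0 < s) (hs1 : s ≤ 1) :
    1 / (2 * Real.cosh 2 * M ^ 2 * s) ≤ roIntegrand φ s := by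
  unfold roIntegrand
  apply one_div_le_one_div_of_le
  · exact mul_pos (sinh_two_mul_pos hs0) (pow_pos (hpos s hs0) 2)
  · have h1 := sinh_two_mul_le_of_le_one hs0.le hs1
    have h2 : φ s ^ 2 ≤ M ^ 2 := pow_le_pow_left₀ (hpos s hs0).le (hM s hs0 hs1) 2
    have h3 : 0 ≤ 2 * s * Real.cosh 2 := by
      have := Real.cosh_pos 2
      positivity
    calc Real.sinh (2 * s) * φ s ^ 2 ≤ (2 * s * Real.cosh 2) * M ^ 2 :=
          mul_le_mul h1 h2 (pow_pos (hpos s hs0) 2).le h3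
      _ = 2 * Real.cosh 2 * M ^ 2 * s := by ring

include hφ hpos hM in
/-- **`I(t) ≤ log t / (2 cosh 2 · M²)`** for `0 < t < 1`: the reduction-of-order integral diverges at least
logarithmically as `t → 0⁺`. -/
theorem roIntegral_le_log {t : ℝ} (ht0 : 0 < t) (ht1 : t < 1) :
    roIntegral φ t ≤ Real.log t / (2 * Real.cosh 2 * M ^ 2) := by
  have hM0 := M_pos hpos hM
  have hK : 0 < 2 * Real.cosh 2 * M ^ 2 := by
    have := Real.cosh_pos 2
    positivity
  have hint : IntervalIntegrable (roIntegrand φ) volume t 1 :=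
    (intervalIntegrable_roIntegrand hφ hpos ht0).symm
  have hcomp : IntervalIntegrable (fun s => 1 / (2 * Real.cosh 2 * M ^ 2 * s)) volume t 1 := by
    refine intervalIntegrable_one_div (fun x hx => ?_) (continuousOn_const.mul continuousOn_id)
    rcases Set.mem_uIcc.mp hx with ⟨h1, _⟩ | ⟨h1, _⟩
    · exact (mul_pos hK (lt_of_lt_of_le ht0 h1)).ne'
    · exact (mul_pos hK (lt_of_lt_of_le one_pos h1)).ne'
  have hmono : ∫ s in t..1, 1 / (2 * Real.cosh 2 * M ^ 2 * s) ≤ ∫ s in t..1, roIntegrand φ s := by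
    refine integral_mono_on ht1.le hcomp hint (fun s hs => ?_)
    exact inv_le_roIntegrand hpos hM (lt_of_lt_of_le ht0 hs.1) hs.2
  have hval : ∫ s in t..1, 1 / (2 * Real.cosh 2 * M ^ 2 * s) = -Real.log t / (2 * Real.cosh 2 * M ^ 2) := by
    have e : (fun s : ℝ => 1 / (2 * Real.cosh 2 * M ^ 2 * s)) = fun s => (2 * Real.cosh 2 * M ^ 2)⁻¹ * s⁻¹ := by
      funext s
      rw [one_div, mul_inv]
    rw [e, intervalIntegral.integral_const_mul, integral_inv_of_pos ht0 one_pos, one_div, Real.log_inv]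
    ring
  unfold roIntegral
  rw [integral_symm, neg_le, ← neg_div, ← hval]
  exact hmono

include hφ hpos hm hM in
/-- **`v(t) ≤ m · log t / (2 cosh 2 · M²)`** for `0 < t < 1`. -/
theorem secondSolution_le_log (hm0 : 0 < m) {t : ℝ} (ht0 : 0 < t) (ht1 : t < 1) :
    secondSolution φ t ≤ m * (Real.log t / (2 * Real.cosh 2 * M ^ 2)) := by
  have hI := roIntegral_le_log hφ hpos hM ht0 ht1
  have hI0 : roIntegral φ t ≤ 0 := (roIntegral_neg hφ hpos ht0 ht1).le
  unfold secondSolution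
  calc φ t * roIntegral φ t ≤ m * roIntegral φ t := mul_le_mul_of_nonpos_right (hm t ht0 ht1.le) hI0
    _ ≤ m * (Real.log t / (2 * Real.cosh 2 * M ^ 2)) := mul_le_mul_of_nonneg_left hI hm0.le

include hφ hpos hm hM in
/-- **`v(t) → −∞` as `t → 0⁺`.** -/
theorem tendsto_secondSolution_nhdsGT_zero (hm0 : 0 < m) :
    Tendsto (secondSolution φ) (𝓝[>] 0) atBot := by
  have hK : 0 < 2 * Real.cosh 2 * M ^ 2 := by
    have := M_pos hpos hM
    have := Real.cosh_pos 2
    positivity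
  have h1 : Tendsto (fun t : ℝ => m * (Real.log t / (2 * Real.cosh 2 * M ^ 2))) (𝓝[>] 0) atBot :=
    (Real.tendsto_log_nhdsGT_zero.atBot_div_const hK).const_mul_atBot hm0
  have h2 : Tendsto (fun t : ℝ => -(m * (Real.log t / (2 * Real.cosh 2 * M ^ 2)))) (𝓝[>] 0) atTop :=
    tendsto_neg_atTop_iff.mpr h1
  have h3 : Tendsto (fun t => -secondSolution φ t) (𝓝[>] 0) atTop := by
    refine tendsto_atTop_mono' _ ?_ h2
    filter_upwards [Ioo_mem_nhdsGT (zero_lt_one' ℝ)] with t ht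
    have := secondSolution_le_log hφ hpos hm hM hm0 ht.1 ht.2
    linarith
  exact tendsto_neg_atTop_iff.mp h3

/-! ### The regular solution is unique -/

include hφ hφ' hpos hm hM in
/-- **THE REGULAR SOLUTION IS UNIQUE**: a solution `u` of `sinh 2t · u″ + 2 cosh 2t · u′ = μ sinh 2t · u` on
`(0, ∞)` that stays bounded as `t → 0⁺` has no `v`-component: `u = (u(1)/φ(1)) · φ` on `(0, ∞)`. -/
theorem eq_const_mul_of_bounded (hm0 : 0 < m)
    (hode : ∀ t, 0 < t → Real.sinh (2 * t) * φ'' t + 2 * Real.cosh (2 * t) * φ' t = μ * Real.sinh (2 * t) * φ t)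
    {u u' u'' : ℝ → ℝ} (hu : ∀ t, 0 < t → HasDerivAt u (u' t) t) (hu' : ∀ t, 0 < t → HasDerivAt u' (u'' t) t)
    (huode : ∀ t, 0 < t → Real.sinh (2 * t) * u'' t + 2 * Real.cosh (2 * t) * u' t = μ * Real.sinh (2 * t) * u t)
    {B : ℝ} (hB : ∀ᶠ t in 𝓝[>] (0 : ℝ), |u t| ≤ B) {t : ℝ} (ht : 0 < t) :
    u t = (u 1 / φ 1) * φ t := by
  set a := u 1 / φ 1 with ha
  set b := Real.sinh 2 * (φ 1 * u' 1 - φ' 1 * u 1) with hb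
  have hrep : ∀ s, 0 < s → u s = a * φ s + b * secondSolution φ s :=
    fun s hs => eq_add_of_ode hφ hφ' hpos hode hu hu' huode hs
  have hb0 : b = 0 := by
    by_contra hb0
    have hbpos : 0 < |b| := abs_pos.mpr hb0
    have hv := tendsto_secondSolution_nhdsGT_zero hφ hpos hm hM hm0
    have h1 : Tendsto (fun s => |b| * (-secondSolution φ s)) (𝓝[>] 0) atTop :=
      (tendsto_neg_atTop_iff.mpr hv).const_mul_atTop hbpos
    have h2 : ∀ᶠ s in 𝓝[>] (0 : ℝ), |b| * (-secondSolution φ s) ≤ B + |a| * M := by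
      filter_upwards [hB, Ioo_mem_nhdsGT (zero_lt_one' ℝ)] with s hBs hs
      have e := hrep s hs.1
      have hφs : |φ s| ≤ M := by
        rw [abs_of_pos (hpos s hs.1)]
        exact hM s hs.1 hs.2.le
      calc |b| * (-secondSolution φ s) ≤ |b| * |secondSolution φ s| :=
            mul_le_mul_of_nonneg_left (neg_le_abs _) (abs_nonneg _)
        _ = |b * secondSolution φ s| := (abs_mul _ _).symm
        _ = |u s - a * φ s| := by
            congr 1
            rw [e]
            ring
        _ ≤ |u s| + |a * φ s| := abs_sub _ _
        _ = |u s| + |a| * |φ s| := by rw [abs_mul]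
        _ ≤ B + |a| * M := add_le_add hBs (mul_le_mul_of_nonneg_left hφs (abs_nonneg _))
    obtain ⟨s, hs1, hs2⟩ := ((h1.eventually (eventually_gt_atTop (B + |a| * M))).and h2).exists
    linarith
  rw [hrep t ht, hb0, zero_mul, add_zero]

include hφ hφ' hpos hm hM in
/-- A solution with a FINITE LIMIT as `t → 0⁺` is `(u(1)/φ(1)) · φ`. -/
theorem eq_const_mul_of_tendsto (hm0 : 0 < m)
    (hode : ∀ t, 0 < t → Real.sinh (2 * t) * φ'' t + 2 * Real.cosh (2 * t) * φ' t = μ * Real.sinh (2 * t) * φ t)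
    {u u' u'' : ℝ → ℝ} (hu : ∀ t, 0 < t → HasDerivAt u (u' t) t) (hu' : ∀ t, 0 < t → HasDerivAt u' (u'' t) t)
    (huode : ∀ t, 0 < t → Real.sinh (2 * t) * u'' t + 2 * Real.cosh (2 * t) * u' t = μ * Real.sinh (2 * t) * u t)
    {L : ℝ} (hL : Tendsto u (𝓝[>] 0) (𝓝 L)) {t : ℝ} (ht : 0 < t) :
    u t = (u 1 / φ 1) * φ t := by
  refine eq_const_mul_of_bounded hφ hφ' hpos hm hM hm0 hode hu hu' huode (B := |L| + 1) ?_ ht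
  filter_upwards [hL.eventually (eventually_abs_sub_lt L one_pos)] with s hs
  calc |u s| = |(u s - L) + L| := by ring_nf
    _ ≤ |u s - L| + |L| := abs_add_le _ _
    _ ≤ |L| + 1 := by linarith

include hφ hφ' hpos hm hM in
/-- A solution bounded as `t → 0⁺` is a constant multiple of `φ` on `(0, ∞)`. -/
theorem exists_eq_const_mul_of_bounded (hm0 : 0 < m)
    (hode : ∀ t, 0 < t → Real.sinh (2 * t) * φ'' t + 2 * Real.cosh (2 * t) * φ' t = μ * Real.sinh (2 * t) * φ t)
    {u u' u'' : ℝ → ℝ} (hu : ∀ t, 0 < t → HasDerivAt u (u' t) t) (hu' : ∀ t, 0 < t → HasDerivAt u' (u'' t) t)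
    (huode : ∀ t, 0 < t → Real.sinh (2 * t) * u'' t + 2 * Real.cosh (2 * t) * u' t = μ * Real.sinh (2 * t) * u t)
    {B : ℝ} (hB : ∀ᶠ t in 𝓝[>] (0 : ℝ), |u t| ≤ B) :
    ∃ c : ℝ, ∀ t, 0 < t → u t = c * φ t :=
  ⟨u 1 / φ 1, fun _ ht => eq_const_mul_of_bounded hφ hφ' hpos hm hM hm0 hode hu hu' huode hB ht⟩

end

end Summit.Ventures.HodgeRepro2.T5SU11ReductionOfOrderOrigin
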